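import Summits.ResolutionOfSingularities.ResolutionOfSingularities.Theorems.HilbertSamuelEliminationSigmaMaxModificationsCorridor3WLadderIsoTailsArcTranslated
import Literature.AlgebraicGeometry.Resolution.RsopMonomialIdeals
import Literature.AlgebraicGeometry.Resolution.PowerSeriesRegularLocal
import Literature.AlgebraicGeometry.Resolution.SmoothImpliesRegular
import Mathlib.RingTheory.MvPowerSeries.Inverse
import HarnessLib

/-!
# [OURS · L1 W4.2 · D14 «K1 FREE-RATIONAL TAILS»] The ARC IDEAL `(y_i − Σ_k c_{k,i} t^k)_{i=1,2,3}` of `κ⟦t, y₁, y₂, y₃⟧` is a PRIME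
# with REGULAR quotient of dimension `1` (D14-BRIDGE-CUT ROUTE H, input of 001's H7; crux `SigmaMaxModifications`
# stmt-ResolutionOfSingularities-18506 / conjunct stmt-…-19249; kernel `IsoQuadraticTowerTerminates p 3`, card C5 K1)

Lead prover res-L1-w42-lead-1 (gen 4), deal D14; sequel of `…Corridor3WLadderIsoTailsArcTranslated` (p521756). Helper file
`--supports stmt-ResolutionOfSingularities-19249 --as helper`; kernel only; the one definition `Series.arcFrame` names the three arc
coordinates. OURS (cell res-hironaka, slot W4.2); NOT statements of [Hironaka2017] nor of [CossartJannsenSaito2020] / [CossartPiltant2009].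
AI-written; AI review is weaker than expert review.

## What is proved (every field `K`, every `c : ℕ → Fin 4 → K`)

* `Series.arcFrame c : Fin 3 → K⟦t, y⟧`, `arcFrame c i = X i.succ − tSeries (c · i.succ)`; `Series.range_arcFrame` — its range is the
  generating set `{X i − tSeries (c · i)}_{i=1,2,3}` of the ideal in `FormalFrame.mem_pow_of_frameTower` (p524558) /
  `Series.mem_pow_of_translatedStrictTransforms` (p521756).
* **`Series.isRsopPart_arcFrame`** — the arc coordinates are PART OF A REGULAR SYSTEM OF PARAMETERS (completed by `t`; tree `IsRsopPart`,
  `isRegularLocalRing_mvPowerSeries`, `maximalIdeal_mvPowerSeries_eq_span`; `X i.succ = arcFrame c i + t·q` by `X_zero_dvd_tSeries`).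
* Hence (tree `RsopMonomialIdeals`, Matsumura Thm. 14.2): **`Series.isPrime_span_arcFrame`**, **`Series.isRegularLocalRing_quotient_arcFrame`**,
  **`Series.ringKrullDim_quotient_arcFrame : ringKrullDim (K⟦t,y⟧ ⧸ (arc ideal)) = 1`** — exactly the hypotheses `[P.IsPrime]`,
  `[IsRegularLocalRing (R ⧸ P)]`, `ringKrullDim (R ⧸ P) = 1` of res-type-001's H7 `IsoTailsHS.not_isIsolatedInHSMaxLocus_closedPoint_of_arc`
  (p521221) for `R := K⟦t, y⟧`, `P :=` the arc ideal.

References: H. Matsumura, *Commutative Ring Theory*, Thm. 14.2 [Matsumura1987]; idea-1 card C5 (Sketch d9de4647629be5a3).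
-/

noncomputable section

set_option linter.dupNamespace false -- mandated namespace of this single-conjunct summit

open MvPowerSeries IsLocalRing
open Literature.AlgebraicGeometry.Resolution

namespace Summit.ResolutionOfSingularities.ResolutionOfSingularities.Cruxes.SigmaMaxModifications.IdeasL1C5

universe u

namespace Series

variable {K : Type u} [Field K]

/-- `t` divides every series in `t` alone without constant term. [folklore] -/
theorem X_zero_dvd_tSeries (f : ℕ → K) : (X 0 : MvPowerSeries (Fin 4) K) ∣ tSeries f := by
  rw [X_dvd_iff]
  intro e he
  rw [coeff_tSeries, if_neg]
  rintro ⟨_, h0⟩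
  omega

/-- The ARC FRAME `y_i − Σ_{k≥1} c_{k,i} t^k` (`i = 1, 2, 3`), indexed by `Fin 3`. [folklore] -/
def arcFrame (c : ℕ → Fin 4 → K) : Fin 3 → MvPowerSeries (Fin 4) K :=
  fun i => X i.succ - tSeries (fun k => c k i.succ)

/-- Unfolding `arcFrame`. [folklore] -/
theorem arcFrame_apply (c : ℕ → Fin 4 → K) (i : Fin 3) : arcFrame c i = X i.succ - tSeries (fun k => c k i.succ) := rfl

/-- The set of the three arc coordinates is the range of `arcFrame`. [folklore] -/
theorem range_arcFrame (c : ℕ → Fin 4 → K) :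
    Set.range (arcFrame c) = ({X 1 - tSeries (fun k => c k 1), X 2 - tSeries (fun k => c k 2),
      X 3 - tSeries (fun k => c k 3)} : Set (MvPowerSeries (Fin 4) K)) := by
  ext f
  simp only [Set.mem_range, Set.mem_insert_iff, Set.mem_singleton_iff, arcFrame]
  constructor
  · rintro ⟨i, rfl⟩
    fin_cases i
    · exact Or.inl rfl
    · exact Or.inr (Or.inl rfl)
    · exact Or.inr (Or.inr rfl)
  · rintro (rfl | rfl | rfl)
    · exact ⟨0, rfl⟩
    · exact ⟨1, rfl⟩
    · exact ⟨2, rfl⟩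

/-- Every arc coordinate lies in the maximal ideal. [folklore] -/
theorem arcFrame_mem_maximalIdeal (c : ℕ → Fin 4 → K) (i : Fin 3) :
    arcFrame c i ∈ maximalIdeal (MvPowerSeries (Fin 4) K) := by
  rw [arcFrame_apply]
  obtain ⟨q, hq⟩ := X_zero_dvd_tSeries (K := K) (fun k => c k i.succ)
  rw [hq]
  exact Ideal.sub_mem _ (X_mem_maximalIdeal K (Fin 4) _) (Ideal.mul_mem_right _ _ (X_mem_maximalIdeal K (Fin 4) 0))

/-- **The arc coordinates are PART OF A REGULAR SYSTEM OF PARAMETERS of `K⟦t, y₁, y₂, y₃⟧`** (completed by `t`). [folklore] -/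
theorem isRsopPart_arcFrame (c : ℕ → Fin 4 → K) : IsRsopPart (arcFrame c) := by
  refine ⟨isRegularLocalRing_mvPowerSeries K (Fin 4), 1, ![X 0], ?_, ?_⟩
  · rw [ringKrullDim_mvPowerSeries, Nat.card_eq_fintype_card, Fintype.card_fin]
  · apply le_antisymm
    · rw [Ideal.span_le]
      rintro f (⟨i, rfl⟩ | ⟨j, rfl⟩)
      · exact arcFrame_mem_maximalIdeal c i
      · fin_cases j
        exact X_mem_maximalIdeal K (Fin 4) 0
    · -- `𝔪 = (X 0, …, X 3)` and `X (i+1) = arcFrame i + t · q`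
      rw [maximalIdeal_mvPowerSeries_eq_span, Ideal.span_le]
      rintro f ⟨i, rfl⟩
      have h0 : (X 0 : MvPowerSeries (Fin 4) K) ∈ Ideal.span (Set.range (arcFrame c) ∪ Set.range ![X 0]) :=
        Ideal.subset_span (Or.inr ⟨0, rfl⟩)
      by_cases hi : i = 0
      · subst hi; exact h0
      · obtain ⟨j, rfl⟩ : ∃ j : Fin 3, i = j.succ := ⟨i.pred hi, (Fin.succ_pred i hi).symm⟩
        have hj : arcFrame c j ∈ Ideal.span (Set.range (arcFrame c) ∪ Set.range ![X 0]) :=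
          Ideal.subset_span (Or.inl ⟨j, rfl⟩)
        obtain ⟨q, hq⟩ := X_zero_dvd_tSeries (K := K) (fun k => c k j.succ)
        have : (X j.succ : MvPowerSeries (Fin 4) K) = arcFrame c j + X 0 * q := by
          rw [arcFrame_apply, ← hq]; ring
        rw [SetLike.mem_coe, this]
        exact Ideal.add_mem _ hj (Ideal.mul_mem_right _ _ h0)

/-- **THE ARC IDEAL IS PRIME.** [folklore] -/
theorem isPrime_span_arcFrame (c : ℕ → Fin 4 → K) : (Ideal.span (Set.range (arcFrame c))).IsPrime :=
  (isRsopPart_arcFrame c).isPrime_span_range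

/-- **THE ARC IS A REGULAR CURVE GERM**: `K⟦t, y⟧ ⧸ (arc ideal)` is a regular local ring … [folklore] -/
theorem isRegularLocalRing_quotient_arcFrame (c : ℕ → Fin 4 → K) :
    IsRegularLocalRing (MvPowerSeries (Fin 4) K ⧸ Ideal.span (Set.range (arcFrame c))) :=
  (isRsopPart_arcFrame c).isRegularLocalRing_quotient

/-- … of Krull dimension `1`. [folklore] -/
theorem ringKrullDim_quotient_arcFrame (c : ℕ → Fin 4 → K) :
    ringKrullDim (MvPowerSeries (Fin 4) K ⧸ Ideal.span (Set.range (arcFrame c))) = (1 : ℕ) := by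
  have h := (isRsopPart_arcFrame c).ringKrullDim_quotient_add
  rw [ringKrullDim_mvPowerSeries, Nat.card_eq_fintype_card, Fintype.card_fin] at h
  -- `d + 3 = 4` in `WithBot ℕ∞` with `d` the (finite, nonnegative) dimension of a noetherian local ring
  haveI := isRegularLocalRing_quotient_arcFrame c
  obtain ⟨n, hn⟩ := exists_ringKrullDim_eq_natCast (MvPowerSeries (Fin 4) K ⧸ Ideal.span (Set.range (arcFrame c)))
  rw [hn] at h ⊢
  have h' : ((n + 3 : ℕ) : WithBot ℕ∞) = ((4 : ℕ) : WithBot ℕ∞) := by exact_mod_cast h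
  have : n + 3 = 4 := by exact_mod_cast h'
  congr 1
  omega

end Series

end Summit.ResolutionOfSingularities.ResolutionOfSingularities.Cruxes.SigmaMaxModifications.IdeasL1C5

end
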